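import Mathlib
import Literature.Geometry.Lorentzian.ReggeWheelerChannels
import Literature.Geometry.Lorentzian.ReggeWheelerTortoise
import Summits.FinalStateConjecture.FinalStateConjecture.Theorems.PhotonSphereChannelsRWPotential

/-!
# `WindowedShellChannels` (stmt-FinalStateConjecture-14085), the logarithmic lag law — I: the
# photon-sphere potential `q = (1 − 2M/r)/r²` along the tortoise line

Support file (prover seat 1; everything proved, no definitions) for the LOGARITHMIC LAG LAW of the
crux `…Theses.PhotonSphereChannels.WindowedShellChannels`: every witness pair `(h, c)` of the crux at
`(M, ρ)` has `h ≥ θ·M·log(M/ρ)` for all `θ < 3√3` and small `ρ` (the lag must diverge like the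
Lyapunov time of the photon sphere). The witnesses are Gaussian-beam rest packets for the `s = 1`
(Maxwell) Regge–Wheeler equation `ψ_tt − ψ_xx + ℓ(ℓ+1) q(x) ψ = 0`, whose potential is the pure
centrifugal term: `linePotential M 1 ℓ r = ℓ(ℓ+1)·q`, `q(x) = (1 − 2M/r(x))/r(x)²`
(`linePotential_one_eq`). This file collects the calculus of `q` along a tortoise radius function
(`IsTortoiseRadius M r xc`, `dr/dx = 1 − 2M/r`, `r(xc) = 3M`):

* `contDiff_photonQ` — `q ∈ C^n` for every `n` (from `Theorems.tortoise_contDiff`);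
* `hasDerivAt_photonQ` — `q′ = (1 − 2M/r)·2(3M − r)/r⁴`: zero at the photon sphere
  (`deriv_photonQ_center`), `≤ 0` to its right and `≥ 0` to its left (`deriv_photonQ_nonpos`,
  `deriv_photonQ_nonneg`) — the photon sphere is the unique maximum;
* `hasDerivAt_deriv_photonQ` — `q″ = (1 − 2M/r)(6/r⁴ − 40M/r⁵ + 60M²/r⁶)`, with
  `q″(xc) = −2/(729M⁴)` (`iteratedDeriv_two_photonQ_center`), `q(xc) = 1/(27M²)`
  (`photonQ_center`): the Lyapunov exponent of the null geodesic flow at the photon sphere is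
  `λ = √(−q″(xc)/(2q(xc))) = 1/(3√3 M)`;
* `abs_deriv_deriv_photonQ_le`, `lipschitzWith_deriv_photonQ` — `|q″| ≤ 3/M⁴`, so `q′` is
  globally Lipschitz (the hypothesis of `Literature.Analysis.ODE.exists_beamPhase`);
* `photonQ_pos`, `photonQ_le` — `0 < q ≤ 1/(4M²)`.
-/

noncomputable section

-- every `Summit.FinalStateConjecture.FinalStateConjecture.…` name repeats the summit = sub-problem
-- segment (D-0017 layout), as in every landed `…Theorems` file of this route
set_option linter.dupNamespace false

namespace Summit.FinalStateConjecture.FinalStateConjecture.Theorems.LagLaw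

open Literature.Geometry.Lorentzian Literature.Geometry.Lorentzian.ReggeWheeler Set Filter Topology
open scoped NNReal

variable {M : ℝ} {r : ℝ → ℝ} {xc : ℝ}

/-- **The `s = 1` Regge–Wheeler potential is `ℓ(ℓ+1)` times `q = (1 − 2M/r)/r²`.** -/
theorem linePotential_one_eq (M : ℝ) (ℓ : ℕ) (r : ℝ → ℝ) :
    linePotential M 1 ℓ r = fun x => ((ℓ : ℝ) * ((ℓ : ℝ) + 1)) * ((1 - 2 * M / r x) / r x ^ 2) := by
  funext x
  rw [linePotential_apply, rwPotential_one]
  ring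

/-- `q` is `C^n` along a tortoise radius function, for every `n`. -/
theorem contDiff_photonQ (hr : IsTortoiseRadius M r xc) (n : ℕ∞) :
    ContDiff ℝ n fun x => (1 - 2 * M / r x) / r x ^ 2 := by
  have hrc : ContDiff ℝ n r := tortoise_contDiff hr.mass_pos hr.two_mul_lt hr.hasDerivAt hr.center n
  have hr0 : ∀ x, r x ≠ 0 := fun x => (hr.pos x).ne'
  exact (contDiff_const.sub (contDiff_const.div hrc hr0)).div (hrc.pow 2) fun x => pow_ne_zero 2 (hr0 x)

/-- **`q′ = (1 − 2M/r)·2(3M − r)/r⁴`.** -/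
theorem hasDerivAt_photonQ (hr : IsTortoiseRadius M r xc) (x : ℝ) :
    HasDerivAt (fun x => (1 - 2 * M / r x) / r x ^ 2)
      ((2 * (3 * M - r x) / r x ^ 4) * (1 - 2 * M / r x)) x := by
  have hr0 : r x ≠ 0 := (hr.pos x).ne'
  have hg : HasDerivAt (fun ρ : ℝ => (1 - 2 * M / ρ) / ρ ^ 2) (2 * (3 * M - r x) / r x ^ 4) (r x) := by
    have he : ∀ ρ : ℝ, ρ ≠ 0 → (1 - 2 * M / ρ) / ρ ^ 2 = ρ⁻¹ ^ 2 - 2 * M * ρ⁻¹ ^ 3 := by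
      intro ρ hρ; field_simp
    have hev : (fun ρ : ℝ => (1 - 2 * M / ρ) / ρ ^ 2) =ᶠ[𝓝 (r x)] fun ρ => ρ⁻¹ ^ 2 - 2 * M * ρ⁻¹ ^ 3 := by
      filter_upwards [isOpen_ne.mem_nhds hr0] with ρ hρ using he ρ hρ
    refine HasDerivAt.congr_of_eventuallyEq ?_ hev
    have hi := hasDerivAt_inv hr0
    have h := (hi.pow 2).sub ((hi.pow 3).const_mul (2 * M))
    convert h using 1
    · funext ρ; simp only [Pi.pow_apply, Pi.sub_apply]
    · simp only [inv_pow]; field_simp; ring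
  exact hg.comp x (hr.hasDerivAt x)

/-- `deriv q` as a function. -/
theorem deriv_photonQ_eq (hr : IsTortoiseRadius M r xc) :
    deriv (fun x => (1 - 2 * M / r x) / r x ^ 2)
      = fun x => (2 * (3 * M - r x) / r x ^ 4) * (1 - 2 * M / r x) :=
  funext fun x => (hasDerivAt_photonQ hr x).deriv

/-- The photon sphere is a critical point of `q`: `q′(xc) = 0`. -/
theorem deriv_photonQ_center (hr : IsTortoiseRadius M r xc) :
    deriv (fun x => (1 - 2 * M / r x) / r x ^ 2) xc = 0 := by
  rw [deriv_photonQ_eq hr]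
  simp only [hr.center]
  ring

/-- `q′ ≤ 0` to the right of the photon sphere. -/
theorem deriv_photonQ_nonpos (hr : IsTortoiseRadius M r xc) {x : ℝ} (hx : xc ≤ x) :
    deriv (fun x => (1 - 2 * M / r x) / r x ^ 2) x ≤ 0 := by
  rw [deriv_photonQ_eq hr]
  have h3 : 3 * M ≤ r x := by rw [← hr.center]; exact hr.strictMono.monotone hx
  have hf : 0 ≤ 1 - 2 * M / r x := (hr.deriv_pos x).le
  have hr4 : 0 < r x ^ 4 := pow_pos (hr.pos x) 4
  have : 2 * (3 * M - r x) / r x ^ 4 ≤ 0 := div_nonpos_of_nonpos_of_nonneg (by linarith) hr4.le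
  exact mul_nonpos_of_nonpos_of_nonneg this hf

/-- `q′ ≥ 0` to the left of the photon sphere. -/
theorem deriv_photonQ_nonneg (hr : IsTortoiseRadius M r xc) {x : ℝ} (hx : x ≤ xc) :
    0 ≤ deriv (fun x => (1 - 2 * M / r x) / r x ^ 2) x := by
  rw [deriv_photonQ_eq hr]
  have h3 : r x ≤ 3 * M := by rw [← hr.center]; exact hr.strictMono.monotone hx
  have hf : 0 ≤ 1 - 2 * M / r x := (hr.deriv_pos x).le
  have hr4 : 0 < r x ^ 4 := pow_pos (hr.pos x) 4
  exact mul_nonneg (div_nonneg (by linarith) hr4.le) hf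

/-- **`q″ = (1 − 2M/r)(6/r⁴ − 40M/r⁵ + 60M²/r⁶)`.** -/
theorem hasDerivAt_deriv_photonQ (hr : IsTortoiseRadius M r xc) (x : ℝ) :
    HasDerivAt (deriv fun x => (1 - 2 * M / r x) / r x ^ 2)
      ((6 / r x ^ 4 - 40 * M / r x ^ 5 + 60 * M ^ 2 / r x ^ 6) * (1 - 2 * M / r x)) x := by
  rw [deriv_photonQ_eq hr]
  have hr0 : r x ≠ 0 := (hr.pos x).ne'
  -- `φ(ρ) = 2(3M − ρ)/ρ⁴·(1 − 2M/ρ) = 10M/ρ⁴ − 2/ρ³ − 12M²/ρ⁵`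
  have hφ : HasDerivAt (fun ρ : ℝ => (2 * (3 * M - ρ) / ρ ^ 4) * (1 - 2 * M / ρ))
      (6 / r x ^ 4 - 40 * M / r x ^ 5 + 60 * M ^ 2 / r x ^ 6) (r x) := by
    have he : ∀ ρ : ℝ, ρ ≠ 0 → (2 * (3 * M - ρ) / ρ ^ 4) * (1 - 2 * M / ρ)
        = 10 * M * ρ⁻¹ ^ 4 - 2 * ρ⁻¹ ^ 3 - 12 * M ^ 2 * ρ⁻¹ ^ 5 := by
      intro ρ hρ; field_simp; ring
    have hev : (fun ρ : ℝ => (2 * (3 * M - ρ) / ρ ^ 4) * (1 - 2 * M / ρ))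
        =ᶠ[𝓝 (r x)] fun ρ => 10 * M * ρ⁻¹ ^ 4 - 2 * ρ⁻¹ ^ 3 - 12 * M ^ 2 * ρ⁻¹ ^ 5 := by
      filter_upwards [isOpen_ne.mem_nhds hr0] with ρ hρ using he ρ hρ
    refine HasDerivAt.congr_of_eventuallyEq ?_ hev
    have hi := hasDerivAt_inv hr0
    have h := (((hi.pow 4).const_mul (10 * M)).sub ((hi.pow 3).const_mul 2)).sub
      ((hi.pow 5).const_mul (12 * M ^ 2))
    convert h using 1
    · funext ρ; simp only [Pi.pow_apply, Pi.sub_apply]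
    · simp only [inv_pow]; field_simp; ring
  exact hφ.comp x (hr.hasDerivAt x)

/-- `q″` as a function. -/
theorem deriv_deriv_photonQ_eq (hr : IsTortoiseRadius M r xc) :
    deriv (deriv fun x => (1 - 2 * M / r x) / r x ^ 2)
      = fun x => (6 / r x ^ 4 - 40 * M / r x ^ 5 + 60 * M ^ 2 / r x ^ 6) * (1 - 2 * M / r x) :=
  funext fun x => (hasDerivAt_deriv_photonQ hr x).deriv

/-- **`q″(xc) = −2/(729 M⁴)`** (the photon sphere is a NONDEGENERATE maximum). -/
theorem iteratedDeriv_two_photonQ_center (hr : IsTortoiseRadius M r xc) :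
    iteratedDeriv 2 (fun x => (1 - 2 * M / r x) / r x ^ 2) xc = -2 / (729 * M ^ 4) := by
  have hM : M ≠ 0 := hr.mass_pos.ne'
  rw [iteratedDeriv_succ, iteratedDeriv_one, deriv_deriv_photonQ_eq hr]
  simp only [hr.center]
  field_simp
  norm_num

/-- **`q(xc) = 1/(27M²)`.** -/
theorem photonQ_center (hr : IsTortoiseRadius M r xc) :
    (1 - 2 * M / r xc) / r xc ^ 2 = 1 / (27 * M ^ 2) := by
  have hM : M ≠ 0 := hr.mass_pos.ne'
  rw [hr.center]
  field_simp
  norm_num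

/-- `0 < q`. -/
theorem photonQ_pos (hr : IsTortoiseRadius M r xc) (x : ℝ) : 0 < (1 - 2 * M / r x) / r x ^ 2 :=
  div_pos (hr.deriv_pos x) (pow_pos (hr.pos x) 2)

/-- `q ≤ 1/(4M²)`. -/
theorem photonQ_le (hr : IsTortoiseRadius M r xc) (x : ℝ) :
    (1 - 2 * M / r x) / r x ^ 2 ≤ 1 / (4 * M ^ 2) := by
  have hM := hr.mass_pos
  have h2 : 2 * M < r x := hr.two_mul_lt x
  have hf : 1 - 2 * M / r x ≤ 1 := (hr.deriv_lt_one x).le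
  have hr2 : 4 * M ^ 2 ≤ r x ^ 2 := by nlinarith
  calc (1 - 2 * M / r x) / r x ^ 2 ≤ 1 / r x ^ 2 :=
        div_le_div_of_nonneg_right hf (pow_pos (hr.pos x) 2).le
    _ ≤ 1 / (4 * M ^ 2) := one_div_le_one_div_of_le (by positivity) hr2

/-- **`|q″| ≤ 3/M⁴`.** -/
theorem abs_deriv_deriv_photonQ_le (hr : IsTortoiseRadius M r xc) (x : ℝ) :
    |deriv (deriv fun x => (1 - 2 * M / r x) / r x ^ 2) x| ≤ 3 / M ^ 4 := by
  rw [deriv_deriv_photonQ_eq hr]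
  have hM := hr.mass_pos
  have h2 : 2 * M < r x := hr.two_mul_lt x
  have hr0 : 0 < r x := hr.pos x
  have hf0 : 0 ≤ 1 - 2 * M / r x := (hr.deriv_pos x).le
  have hf1 : 1 - 2 * M / r x ≤ 1 := (hr.deriv_lt_one x).le
  -- `u = 1/r < 1/(2M)`
  set u : ℝ := (r x)⁻¹ with hu
  have hu0 : 0 < u := inv_pos.2 hr0
  have hu1 : u * (2 * M) < 1 := by rw [hu, inv_mul_lt_iff₀ hr0]; linarith
  have huM : u < 1 / (2 * M) := by rw [lt_div_iff₀ (by positivity)]; exact hu1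
  have he : 6 / r x ^ 4 - 40 * M / r x ^ 5 + 60 * M ^ 2 / r x ^ 6
      = 6 * u ^ 4 - 40 * M * u ^ 5 + 60 * M ^ 2 * u ^ 6 := by
    simp only [hu]; field_simp
  rw [abs_mul, he, abs_of_nonneg hf0]
  -- with `v = 2Mu ∈ [0, 1]`: `6u⁴ − 40Mu⁵ + 60M²u⁶ = ((3/8)v⁴ − (5/4)v⁵ + (15/16)v⁶)/M⁴`
  set v : ℝ := 2 * M * u with hv
  have hv0 : 0 ≤ v := by positivity
  have hv1 : v ≤ 1 := by rw [hv]; linarith [hu1]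
  have hP : 6 * u ^ 4 - 40 * M * u ^ 5 + 60 * M ^ 2 * u ^ 6
      = (1 / M ^ 4) * ((3 / 8) * v ^ 4 - (5 / 4) * v ^ 5 + (15 / 16) * v ^ 6) := by
    simp only [hv]; field_simp; ring
  have hb : |(3 / 8 : ℝ) * v ^ 4 - (5 / 4) * v ^ 5 + (15 / 16) * v ^ 6| ≤ 3 := by
    have h4 : v ^ 4 ≤ 1 := pow_le_one₀ hv0 hv1
    have h5 : v ^ 5 ≤ 1 := pow_le_one₀ hv0 hv1
    have h6 : v ^ 6 ≤ 1 := pow_le_one₀ hv0 hv1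
    have p4 : 0 ≤ v ^ 4 := by positivity
    have p5 : 0 ≤ v ^ 5 := by positivity
    have p6 : 0 ≤ v ^ 6 := by positivity
    rw [abs_le]; constructor <;> linarith
  have hM4 : 0 < 1 / M ^ 4 := by positivity
  rw [hP, abs_mul, abs_of_pos hM4]
  calc 1 / M ^ 4 * |(3 / 8 : ℝ) * v ^ 4 - (5 / 4) * v ^ 5 + (15 / 16) * v ^ 6| * (1 - 2 * M / r x)
      ≤ 1 / M ^ 4 * 3 * 1 := by
        have i1 := mul_le_mul_of_nonneg_left hb hM4.le
        exact mul_le_mul i1 hf1 hf0 (by positivity)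
    _ = 3 / M ^ 4 := by ring

/-- **`q′` is globally Lipschitz** (constant `3/M⁴`). -/
theorem lipschitzWith_deriv_photonQ (hr : IsTortoiseRadius M r xc) :
    LipschitzWith (Real.toNNReal (3 / M ^ 4)) (deriv fun x => (1 - 2 * M / r x) / r x ^ 2) := by
  refine lipschitzWith_of_nnnorm_deriv_le (fun x => (hasDerivAt_deriv_photonQ hr x).differentiableAt) ?_
  intro x
  have h := abs_deriv_deriv_photonQ_le hr x
  have h0 : 0 ≤ 3 / M ^ 4 := by have := hr.mass_pos; positivity
  rw [← NNReal.coe_le_coe, coe_nnnorm, Real.norm_eq_abs, Real.coe_toNNReal _ h0]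
  exact h

/-- **Registered sub-goal `stub_lagLawPhotonQ` of stmt-FinalStateConjecture-14085** (seat 1, the
logarithmic lag law): the calculus of `q` along the tortoise line, bundled. -/
theorem stub_lagLawPhotonQ : ∀ (M : ℝ) (r : ℝ → ℝ) (xc : ℝ), IsTortoiseRadius M r xc → (∀ n : ℕ∞, ContDiff ℝ n fun x => (1 - 2 * M / r x) / r x ^ 2) ∧ deriv (fun x => (1 - 2 * M / r x) / r x ^ 2) xc = 0 ∧ iteratedDeriv 2 (fun x => (1 - 2 * M / r x) / r x ^ 2) xc = -2 / (729 * M ^ 4) ∧ (1 - 2 * M / r xc) / r xc ^ 2 = 1 / (27 * M ^ 2) ∧ (∀ x, xc ≤ x → deriv (fun x => (1 - 2 * M / r x) / r x ^ 2) x ≤ 0) ∧ (∀ x, 0 < (1 - 2 * M / r x) / r x ^ 2) ∧ ∀ x, |deriv (deriv fun x => (1 - 2 * M / r x) / r x ^ 2) x| ≤ 3 / M ^ 4 := by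
  intro M r xc hr
  exact ⟨contDiff_photonQ hr, deriv_photonQ_center hr, iteratedDeriv_two_photonQ_center hr,
    photonQ_center hr, fun x hx => deriv_photonQ_nonpos hr hx, photonQ_pos hr,
    abs_deriv_deriv_photonQ_le hr⟩

end Summit.FinalStateConjecture.FinalStateConjecture.Theorems.LagLaw
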